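import Mathlib
import Literature.Computability.AlgebraicComplexity.RectangularExponent

/-!
# MatrixMultiplication / ShapeSubmodularity — a one-dark-point model of every shape fact the line
`registered` leans on, violating the exchange law at the first core cell

Crux `ShapeSubmodular` (stmt-MatrixMultiplication-15622, route `ShapeSubmodularity`): the rectangular exponent
`(a,b,c) ↦ ω(a,b,c)` is submodular on the format lattice.  Line `registered`
(`Cruxes/ShapeSubmodular/Lines/birth.lean`) reduced the crux, by landed theorems only, to the unit exchange law
`ω(a+1,b+1,c) + ω(a,b,c) ≤ ω(a+1,b,c) + ω(a,b+1,c)` on the certificate-free fat core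
(`Theorems.ShapeSubmodular.ShapeSubmodular_iff_coreNoCert`), whose first cell `(a,b,c) = (1,1,1)` reads
`ω(2,2,1) + ω ≤ 2·ω(1,1,2)`.

This file records, kernel-checked, WHY no further cell of that core can fall to the line's means.  The function
`h(a,b,c) = max (a+b, b+c, a+c, ¾(a+b+c))` — the support function of the flattening triangle
`{(1,1,0),(1,0,1),(0,1,1)}` together with ONE symmetric "dark point" `(¾,¾,¾)` of height `9/4` — satisfies the
abstract form (with `h` in place of `omegaRect ℂ`) of each shape property below; the list covers every property of
`ω(·,·,·)` as a function on formats that the line's files use and every exponent table vendored in the tree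
(2026-08-17):

* `S₃`-symmetry (`omegaRect_rotate`, `omegaRect_swap₂₃`), monotonicity (`tensorRank_matMulTensor_mono₃`,
  `omegaRect_mono_middle`), degree-one homogeneity (`omegaRect_smul`), subadditivity = Kronecker
  submultiplicativity (`Blaser2013_rank_matMulTensor_mul_le`), hence convexity (`omegaRect_convexOn_one_one`);
* the flattening sandwich `max(a+b,b+c,a+c) ≤ ω(a,b,c) ≤ a+b+c` (`max_mul_le_tensorRank_matMulTensor`,
  `tensorRank_matMulTensor_le`), the blocking/Lipschitz bounds `ω(1,1,p) ≤ ω(1,1,q) + (p − q)`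
  (`omegaRect_one_one_le_add`) and `ω ≤ ω(1,a,1) + (1 − a)` (`omega_le_omegaRect_add`);
* the flat region `ω(1,p,1) = 2` for `p ≤ 0.321334` (`vxxz2024_alpha_ge`; the model is flat up to `p = 2/3`),
  the `μ`-row `ω(1,½,1) = 2 = 1 + 2·½` (`omegaRect_muExponent`, `μ ≤ 0.5275`; the model has `μ = ½`);
* EVERY ROW of both vendored record tables `vxxz2024Table` (VXXZ 2024, Table 1, 24 rows) and `advxxz2025Table`
  (ADVXXZ 2025, Table 1, 13 rows), read as `h(1,κ,1) ≤ b`;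

and yet VIOLATES the exchange law at the cell with meet `(1,1,1)`:
`h(2,1,1) + h(1,2,1) = 6 < 25/4 = h(2,2,1) + h(1,1,1)` (room `1/4`, the value found numerically by the c3
census).  Consequently (`exists_thresholdFamily_not_unitExchange`) the threshold family `{β | h ≤ β}` satisfies
the rotation and threshold hypotheses of the line's composition lemma `submod_of_threshold_family` while its
unit-exchange hypothesis `hU` fails: the open stub `stub_coreExchange` is independent of everything the line
leans on, not merely unproved from it.  (Informally: a single symmetric dark spectral point is joined to the
flattening triangle by three-leg edges, so SUBMOD is exactly the statement that the dark part of Strassen's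
spectrum of matrix shapes, if non-empty, is wired to the light part laminarly — new mathematics either way.)

No `def` is introduced: the model is the witness of the existential statements.
-/

namespace Summit.MatrixMultiplication.MatrixMultiplication.Theorems.ShapeSubmodular

open Literature.Computability.AlgebraicComplexity

set_option linter.dupNamespace false
-- (single-conjunct summit: the namespace repeats `MatrixMultiplication`)

/-- Rotating three terms under a `max`. -/
private theorem max3_rotate (x y z : ℝ) : max x (max y z) = max y (max z x) :=
  le_antisymm
    (max_le (le_max_of_le_right (le_max_right _ _))
      (max_le (le_max_left _ _) (le_max_of_le_right (le_max_left _ _))))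
    (max_le (le_max_of_le_right (le_max_left _ _))
      (max_le (le_max_of_le_right (le_max_right _ _)) (le_max_left _ _)))

/-- Swapping the outer two of three terms under a `max`. -/
private theorem max3_swap₁₃ (x y z : ℝ) : max x (max y z) = max z (max y x) :=
  le_antisymm
    (max_le (le_max_of_le_right (le_max_right _ _))
      (max_le (le_max_of_le_right (le_max_left _ _)) (le_max_left _ _)))
    (max_le (le_max_of_le_right (le_max_right _ _))
      (max_le (le_max_of_le_right (le_max_left _ _)) (le_max_left _ _)))

/-- **One dark point models every shape fact of the line and breaks the exchange law at `(1,1,1)`.**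
There is a function `h : ℝ³ → ℝ` — namely `h(a,b,c) = max (a+b, b+c, a+c, ¾(a+b+c))` — which is
`S₃`-symmetric, monotone, positively homogeneous of degree one, subadditive and convex, squeezed between the
flattening exponent and `a+b+c`, `1`-Lipschitz in one coordinate in the two printed forms, flat (`= 2`) on
`ω(1,p,1)` for `0 ≤ p ≤ 2/3 ⊇ [0, 0.321334]`, has the `μ`-row `h(1,½,1) = 1 + 2·½`, lies below every row of the
vendored tables `vxxz2024Table` and `advxxz2025Table`, and nevertheless satisfies
`h(2,1,1) + h(1,2,1) < h(2,2,1) + h(1,1,1)` — the negation of the unit exchange law at the first core cell.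
[folklore] -/
theorem exists_darkPoint_shapeModel :
    ∃ h : ℝ → ℝ → ℝ → ℝ,
      (∀ a b c : ℝ, h a b c = h b c a) ∧
      (∀ a b c : ℝ, h a b c = h a c b) ∧
      (∀ a b c a' b' c' : ℝ, a ≤ a' → b ≤ b' → c ≤ c' → h a b c ≤ h a' b' c') ∧
      (∀ t a b c : ℝ, 0 ≤ t → h (t * a) (t * b) (t * c) = t * h a b c) ∧
      (∀ a b c a' b' c' : ℝ, h (a + a') (b + b') (c + c') ≤ h a b c + h a' b' c') ∧
      (∀ θ a b c a' b' c' : ℝ, 0 ≤ θ → θ ≤ 1 →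
        h (θ * a + (1 - θ) * a') (θ * b + (1 - θ) * b') (θ * c + (1 - θ) * c') ≤
          θ * h a b c + (1 - θ) * h a' b' c') ∧
      (∀ a b c : ℝ, max (a + b) (max (b + c) (a + c)) ≤ h a b c) ∧
      (∀ a b c : ℝ, 0 ≤ a → 0 ≤ b → 0 ≤ c → h a b c ≤ a + b + c) ∧
      (∀ p q : ℝ, q ≤ p → h 1 1 p ≤ h 1 1 q + (p - q)) ∧
      (∀ a : ℝ, a ≤ 1 → h 1 1 1 ≤ h 1 a 1 + (1 - a)) ∧
      (∀ p : ℝ, 0 ≤ p → p ≤ 2 / 3 → h 1 p 1 = 2) ∧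
      h 1 (1 / 2) 1 = 1 + 2 * (1 / 2) ∧
      (∀ κ b : ℝ, (κ, b) ∈ Literature.Computability.AlgebraicComplexity.vxxz2024Table → h 1 κ 1 ≤ b) ∧
      (∀ κ b : ℝ, (κ, b) ∈ Literature.Computability.AlgebraicComplexity.advxxz2025Table → h 1 κ 1 ≤ b) ∧
      h 2 1 1 + h 1 2 1 < h 2 2 1 + h 1 1 1 := by
  refine ⟨fun a b c => max (max (a + b) (max (b + c) (a + c))) (3 / 4 * (a + b + c)),
    ?_, ?_, ?_, ?_, ?_, ?_, ?_, ?_, ?_, ?_, ?_, ?_, ?_, ?_, ?_⟩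
  -- rotation
  · intro a b c
    show max (max (a + b) (max (b + c) (a + c))) (3 / 4 * (a + b + c)) =
      max (max (b + c) (max (c + a) (b + a))) (3 / 4 * (b + c + a))
    rw [max3_rotate (a + b) (b + c) (a + c), add_comm c a, add_comm b a,
      show b + c + a = a + b + c by ring]
  -- swap of the last two coordinates
  · intro a b c
    show max (max (a + b) (max (b + c) (a + c))) (3 / 4 * (a + b + c)) =
      max (max (a + c) (max (c + b) (a + b))) (3 / 4 * (a + c + b))
    rw [add_comm c b, max3_swap₁₃ (a + c) (b + c) (a + b), show a + c + b = a + b + c by ring]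
  -- monotone
  · intro a b c a' b' c' ha hb hc
    exact max_le_max (max_le_max (by linarith) (max_le_max (by linarith) (by linarith))) (by linarith)
  -- homogeneous of degree one
  · intro t a b c ht
    show max (max (t * a + t * b) (max (t * b + t * c) (t * a + t * c))) (3 / 4 * (t * a + t * b + t * c)) =
      t * max (max (a + b) (max (b + c) (a + c))) (3 / 4 * (a + b + c))
    rw [mul_max_of_nonneg _ _ ht, mul_max_of_nonneg _ _ ht, mul_max_of_nonneg _ _ ht]
    congr 1
    · rw [mul_add, mul_add, mul_add]
    · ring
  -- subadditive
  · intro a b c a' b' c'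
    have h₁ : a + b ≤ max (max (a + b) (max (b + c) (a + c))) (3 / 4 * (a + b + c)) :=
      le_max_of_le_left (le_max_left _ _)
    have h₂ : b + c ≤ max (max (a + b) (max (b + c) (a + c))) (3 / 4 * (a + b + c)) :=
      le_max_of_le_left (le_max_of_le_right (le_max_left _ _))
    have h₃ : a + c ≤ max (max (a + b) (max (b + c) (a + c))) (3 / 4 * (a + b + c)) :=
      le_max_of_le_left (le_max_of_le_right (le_max_right _ _))
    have h₄ : 3 / 4 * (a + b + c) ≤ max (max (a + b) (max (b + c) (a + c))) (3 / 4 * (a + b + c)) :=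
      le_max_right _ _
    have h₁' : a' + b' ≤ max (max (a' + b') (max (b' + c') (a' + c'))) (3 / 4 * (a' + b' + c')) :=
      le_max_of_le_left (le_max_left _ _)
    have h₂' : b' + c' ≤ max (max (a' + b') (max (b' + c') (a' + c'))) (3 / 4 * (a' + b' + c')) :=
      le_max_of_le_left (le_max_of_le_right (le_max_left _ _))
    have h₃' : a' + c' ≤ max (max (a' + b') (max (b' + c') (a' + c'))) (3 / 4 * (a' + b' + c')) :=
      le_max_of_le_left (le_max_of_le_right (le_max_right _ _))
    have h₄' : 3 / 4 * (a' + b' + c') ≤ max (max (a' + b') (max (b' + c') (a' + c'))) (3 / 4 * (a' + b' + c')) :=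
      le_max_right _ _
    refine max_le (max_le ?_ (max_le ?_ ?_)) ?_ <;> linarith
  -- convex (from homogeneity and subadditivity, written out)
  · intro θ a b c a' b' c' h0 h1
    have h1' : 0 ≤ 1 - θ := by linarith
    have key : ∀ (s : ℝ), 0 ≤ s → ∀ x y z : ℝ,
        s * x + s * y ≤ s * max (max (x + y) (max (y + z) (x + z))) (3 / 4 * (x + y + z)) ∧
        s * y + s * z ≤ s * max (max (x + y) (max (y + z) (x + z))) (3 / 4 * (x + y + z)) ∧
        s * x + s * z ≤ s * max (max (x + y) (max (y + z) (x + z))) (3 / 4 * (x + y + z)) ∧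
        s * (3 / 4 * (x + y + z)) ≤ s * max (max (x + y) (max (y + z) (x + z))) (3 / 4 * (x + y + z)) := by
      intro s hs x y z
      refine ⟨?_, ?_, ?_, ?_⟩
      · rw [← mul_add]; exact mul_le_mul_of_nonneg_left (le_max_of_le_left (le_max_left _ _)) hs
      · rw [← mul_add]
        exact mul_le_mul_of_nonneg_left (le_max_of_le_left (le_max_of_le_right (le_max_left _ _))) hs
      · rw [← mul_add]
        exact mul_le_mul_of_nonneg_left (le_max_of_le_left (le_max_of_le_right (le_max_right _ _))) hs
      · exact mul_le_mul_of_nonneg_left (le_max_right _ _) hs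
    obtain ⟨k₁, k₂, k₃, k₄⟩ := key θ h0 a b c
    obtain ⟨k₁', k₂', k₃', k₄'⟩ := key (1 - θ) h1' a' b' c'
    refine max_le (max_le ?_ (max_le ?_ ?_)) ?_ <;> nlinarith
  -- flattening from below
  · intro a b c
    exact le_max_left _ _
  -- `a + b + c` from above
  · intro a b c ha hb hc
    refine max_le (max_le ?_ (max_le ?_ ?_)) ?_ <;> linarith
  -- Lipschitz in the third coordinate: `h(1,1,p) ≤ h(1,1,q) + (p - q)` for `q ≤ p`
  · intro p q hqp
    have h₁ : (1 : ℝ) + 1 ≤ max (max ((1 : ℝ) + 1) (max (1 + q) (1 + q))) (3 / 4 * (1 + 1 + q)) :=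
      le_max_of_le_left (le_max_left _ _)
    have h₂ : 1 + q ≤ max (max ((1 : ℝ) + 1) (max (1 + q) (1 + q))) (3 / 4 * (1 + 1 + q)) :=
      le_max_of_le_left (le_max_of_le_right (le_max_left _ _))
    have h₄ : 3 / 4 * (1 + 1 + q) ≤ max (max ((1 : ℝ) + 1) (max (1 + q) (1 + q))) (3 / 4 * (1 + 1 + q)) :=
      le_max_right _ _
    refine max_le (max_le ?_ (max_le ?_ ?_)) ?_ <;> linarith
  -- blocking: `h(1,1,1) ≤ h(1,a,1) + (1 - a)` for `a ≤ 1`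
  · intro a ha
    have h₄ : 3 / 4 * (1 + a + 1) ≤ max (max ((1 : ℝ) + a) (max (a + 1) (1 + 1))) (3 / 4 * (1 + a + 1)) :=
      le_max_right _ _
    have h9 : max (max ((1 : ℝ) + 1) (max (1 + 1) (1 + 1))) (3 / 4 * (1 + 1 + 1)) = 9 / 4 := by norm_num
    beta_reduce
    rw [h9]
    linarith
  -- flat up to `p = 2/3`
  · intro p hp0 hp
    apply le_antisymm
    · refine max_le (max_le ?_ (max_le ?_ ?_)) ?_ <;> linarith
    · exact le_max_of_le_left (le_max_of_le_right (le_max_of_le_right (by norm_num)))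
  -- the `μ`-row
  · norm_num
  -- VXXZ 2024, Table 1
  · intro κ b hmem
    have key : ∀ x ∈ vxxz2024Table,
        max (max ((1 : ℝ) + x.1) (max (x.1 + 1) (1 + 1))) (3 / 4 * (1 + x.1 + 1)) ≤ x.2 := by
      simp only [vxxz2024Table, List.forall_mem_cons, max_le_iff]
      norm_num
    exact key _ hmem
  -- ADVXXZ 2025, Table 1
  · intro κ b hmem
    have key : ∀ x ∈ advxxz2025Table,
        max (max ((1 : ℝ) + x.1) (max (x.1 + 1) (1 + 1))) (3 / 4 * (1 + x.1 + 1)) ≤ x.2 := by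
      simp only [advxxz2025Table, List.forall_mem_cons, max_le_iff]
      norm_num
    exact key _ hmem
  -- the exchange law FAILS at the cell with meet (1,1,1): 3 + 3 < 4 + 9/4
  · norm_num

/-- **Lattice form** (the vocabulary of the line's composition): there is a function `m : ℕ³ → ℝ` which is
rotation- and transposition-invariant, monotone, subadditive, squeezed between the flattening exponent and
`a + b + c` (so exact, `= a + b`, on the boundary `c = 0`), whose threshold family `adm (a,b,c) = {β | m ≤ β}`
therefore satisfies the hypotheses `hrot` (rotation) and `hT` (thresholds) of `submod_of_threshold_family`, and
for which the decreasing-differences law in the coordinate pair (1,2) FAILS at `(a,b,c) = (1,1,1)` and the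
unit-exchange hypothesis `hU` of that lemma FAILS (at `β = β' = 3`, `ε = 1/8`): the open stub of line
`registered` does not follow from the other hypotheses of its own composition plus the listed shape axioms.
[folklore] -/
theorem exists_thresholdFamily_not_unitExchange :
    ∃ m : ℕ → ℕ → ℕ → ℝ,
      (∀ a b c : ℕ, m a b c = m b c a) ∧
      (∀ a b c : ℕ, m a b c = m a c b) ∧
      (∀ a b c a' b' c' : ℕ, a ≤ a' → b ≤ b' → c ≤ c' → m a b c ≤ m a' b' c') ∧
      (∀ a b c a' b' c' : ℕ, m (a + a') (b + b') (c + c') ≤ m a b c + m a' b' c') ∧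
      (∀ a b c : ℕ, ((max (a + b) (max (b + c) (a + c)) : ℕ) : ℝ) ≤ m a b c) ∧
      (∀ a b c : ℕ, m a b c ≤ ((a + b + c : ℕ) : ℝ)) ∧
      (∀ a b : ℕ, m a b 0 = ((a + b : ℕ) : ℝ)) ∧
      ¬ (m (1 + 1) (1 + 1) 1 + m 1 1 1 ≤ m (1 + 1) 1 1 + m 1 (1 + 1) 1) ∧
      (∀ a b c : ℕ, ∀ β : ℝ, β ∈ {β : ℝ | m a b c ≤ β} ↔ β ∈ {β : ℝ | m b c a ≤ β}) ∧
      (∀ a b c : ℕ, ∃ t : ℝ, (∀ β : ℝ, t < β → β ∈ {β : ℝ | m a b c ≤ β}) ∧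
        (∀ β : ℝ, β ∈ {β : ℝ | m a b c ≤ β} → t ≤ β)) ∧
      ¬ (∀ a b c : ℕ, ∀ β β' : ℝ, β ∈ {β : ℝ | m (a + 1) b c ≤ β} → β' ∈ {β : ℝ | m a (b + 1) c ≤ β} →
        ∀ ε : ℝ, 0 < ε → ∃ γ γ' : ℝ, γ + γ' ≤ β + β' + ε ∧
          γ ∈ {β : ℝ | m (a + 1) (b + 1) c ≤ β} ∧ γ' ∈ {β : ℝ | m a b c ≤ β}) := by
  obtain ⟨h, hrot, hswap, hmono, -, hsub, -, hflat, hsum, -, -, -, -, -, -, hviol⟩ :=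
    exists_darkPoint_shapeModel
  refine ⟨fun a b c => h a b c, fun a b c => hrot a b c, fun a b c => hswap a b c, ?_, ?_, ?_, ?_, ?_, ?_,
    ?_, ?_, ?_⟩
  · intro a b c a' b' c' ha hb hc
    exact hmono _ _ _ _ _ _ (by exact_mod_cast ha) (by exact_mod_cast hb) (by exact_mod_cast hc)
  · intro a b c a' b' c'
    have := hsub (a : ℝ) b c a' b' c'
    push_cast
    exact this
  · intro a b c
    have := hflat (a : ℝ) b c
    push_cast
    exact this
  · intro a b c
    have := hsum (a : ℝ) b c (Nat.cast_nonneg a) (Nat.cast_nonneg b) (Nat.cast_nonneg c)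
    push_cast
    exact this
  · intro a b
    apply le_antisymm
    · have := hsum (a : ℝ) b 0 (Nat.cast_nonneg a) (Nat.cast_nonneg b) le_rfl
      push_cast at this ⊢
      linarith
    · have := hflat (a : ℝ) b 0
      push_cast at this ⊢
      exact le_trans (le_max_left _ _) this
  · push_cast
    show ¬ (h 2 2 1 + h 1 1 1 ≤ h 2 1 1 + h 1 2 1)
    rw [not_le]
    have e2 : ((1 : ℕ) : ℝ) + 1 = 2 := by norm_num
    linarith [hviol]
  · intro a b c β
    simp only [Set.mem_setOf_eq]
    rw [hrot a b c]
  · intro a b c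
    refine ⟨h a b c, fun β hβ => ?_, fun β hβ => ?_⟩
    · simp only [Set.mem_setOf_eq]; exact hβ.le
    · simpa only [Set.mem_setOf_eq] using hβ
  · intro hU
    obtain ⟨γ, γ', hsum', hγ, hγ'⟩ := hU 1 1 1 (h 2 1 1) (h 1 2 1)
      (by simp only [Set.mem_setOf_eq]; push_cast; exact le_rfl)
      (by simp only [Set.mem_setOf_eq]; push_cast; exact le_rfl)
      ((h 2 2 1 + h 1 1 1 - h 2 1 1 - h 1 2 1) / 2) (by linarith)
    simp only [Set.mem_setOf_eq] at hγ hγ'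
    push_cast at hγ hγ'
    have e2 : ((1 : ℕ) : ℝ) + 1 = 2 := by norm_num
    linarith

/-! ## The pencil `h_t`, `2/3 < t ≤ 3/4`: independence survives every upper bound short of `ω = 2` -/

/-- The rows of VXXZ 2024 Table 1 have non-negative `κ` and dominate the `t = 3/4` model. -/
private theorem vxxz2024Table_rows :
    ∀ x ∈ Literature.Computability.AlgebraicComplexity.vxxz2024Table,
      0 ≤ x.1 ∧ max (max ((1 : ℝ) + x.1) (max (x.1 + 1) (1 + 1))) (3 / 4 * (1 + x.1 + 1)) ≤ x.2 := by
  simp only [vxxz2024Table, List.forall_mem_cons, max_le_iff]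
  norm_num

/-- The rows of ADVXXZ 2025 Table 1 have non-negative `k` and dominate the `t = 3/4` model. -/
private theorem advxxz2025Table_rows :
    ∀ x ∈ Literature.Computability.AlgebraicComplexity.advxxz2025Table,
      0 ≤ x.1 ∧ max (max ((1 : ℝ) + x.1) (max (x.1 + 1) (1 + 1))) (3 / 4 * (1 + x.1 + 1)) ≤ x.2 := by
  simp only [advxxz2025Table, List.forall_mem_cons, max_le_iff]
  norm_num

/-- **The pencil of dark-point models.**  For EVERY `2/3 < t ≤ 3/4`, `h_t(a,b,c) = max (a+b, b+c, a+c, t·(a+b+c))`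
(flattening triangle plus the dark point `(t,t,t)`, "`ω = 3t`") is `S₃`-symmetric, monotone, degree-one homogeneous,
subadditive, squeezed as `L ≤ h_t ≤ min (a+b+c, L + (t − 2/3)(a+b+c))` — the pencil shrinks onto the flattening function
(the `ω = 2` world) as `t ↓ 2/3` —, flat (`h_t(1,p,1) = 2`) whenever `t (2 + p) ≤ 2`, below every row of both vendored
tables, and violates the exchange law at the cell with meet `(1,1,1)` by EXACTLY `3t − 2 > 0`: no future upper bounds
consistent with some `ω > 2`, and no `α ≥ α₀` with `α₀ < 1`, make the open stub of line `registered` derivable — only a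
super-flattening lower bound or a genuinely relational (non-support-function) law can. [folklore] -/
theorem exists_darkPoint_shapeModel_pencil :
    ∀ t : ℝ, 2 / 3 < t → t ≤ 3 / 4 → ∃ h : ℝ → ℝ → ℝ → ℝ,
      (∀ a b c : ℝ, h a b c = h b c a) ∧
      (∀ a b c : ℝ, h a b c = h a c b) ∧
      (∀ a b c a' b' c' : ℝ, a ≤ a' → b ≤ b' → c ≤ c' → h a b c ≤ h a' b' c') ∧
      (∀ s a b c : ℝ, 0 ≤ s → h (s * a) (s * b) (s * c) = s * h a b c) ∧
      (∀ a b c a' b' c' : ℝ, h (a + a') (b + b') (c + c') ≤ h a b c + h a' b' c') ∧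
      (∀ a b c : ℝ, max (a + b) (max (b + c) (a + c)) ≤ h a b c) ∧
      (∀ a b c : ℝ, 0 ≤ a → 0 ≤ b → 0 ≤ c → h a b c ≤ a + b + c) ∧
      (∀ a b c : ℝ, 0 ≤ a → 0 ≤ b → 0 ≤ c →
        h a b c ≤ max (a + b) (max (b + c) (a + c)) + (t - 2 / 3) * (a + b + c)) ∧
      (∀ p : ℝ, 0 ≤ p → t * (2 + p) ≤ 2 → h 1 p 1 = 2) ∧
      (∀ κ b : ℝ, (κ, b) ∈ Literature.Computability.AlgebraicComplexity.vxxz2024Table → h 1 κ 1 ≤ b) ∧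
      (∀ κ b : ℝ, (κ, b) ∈ Literature.Computability.AlgebraicComplexity.advxxz2025Table → h 1 κ 1 ≤ b) ∧
      h 2 2 1 + h 1 1 1 - (h 2 1 1 + h 1 2 1) = 3 * t - 2 ∧ 0 < 3 * t - 2 := by
  intro t ht ht'
  have ht0 : 0 ≤ t := by linarith
  refine ⟨fun a b c => max (max (a + b) (max (b + c) (a + c))) (t * (a + b + c)),
    ?_, ?_, ?_, ?_, ?_, ?_, ?_, ?_, ?_, ?_, ?_, ?_, by linarith⟩
  -- rotation
  · intro a b c
    show max (max (a + b) (max (b + c) (a + c))) (t * (a + b + c)) =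
      max (max (b + c) (max (c + a) (b + a))) (t * (b + c + a))
    rw [max3_rotate (a + b) (b + c) (a + c), add_comm c a, add_comm b a,
      show b + c + a = a + b + c by ring]
  -- swap of the last two coordinates
  · intro a b c
    show max (max (a + b) (max (b + c) (a + c))) (t * (a + b + c)) =
      max (max (a + c) (max (c + b) (a + b))) (t * (a + c + b))
    rw [add_comm c b, max3_swap₁₃ (a + c) (b + c) (a + b), show a + c + b = a + b + c by ring]
  -- monotone
  · intro a b c a' b' c' ha hb hc
    exact max_le_max (max_le_max (by linarith) (max_le_max (by linarith) (by linarith)))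
      (mul_le_mul_of_nonneg_left (by linarith) ht0)
  -- homogeneous of degree one
  · intro s a b c hs
    show max (max (s * a + s * b) (max (s * b + s * c) (s * a + s * c))) (t * (s * a + s * b + s * c)) =
      s * max (max (a + b) (max (b + c) (a + c))) (t * (a + b + c))
    rw [mul_max_of_nonneg _ _ hs, mul_max_of_nonneg _ _ hs, mul_max_of_nonneg _ _ hs]
    congr 1
    · rw [mul_add, mul_add, mul_add]
    · ring
  -- subadditive
  · intro a b c a' b' c'
    have key : ∀ x y z : ℝ, x + y ≤ max (max (x + y) (max (y + z) (x + z))) (t * (x + y + z)) ∧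
        y + z ≤ max (max (x + y) (max (y + z) (x + z))) (t * (x + y + z)) ∧
        x + z ≤ max (max (x + y) (max (y + z) (x + z))) (t * (x + y + z)) ∧
        t * (x + y + z) ≤ max (max (x + y) (max (y + z) (x + z))) (t * (x + y + z)) := fun x y z =>
      ⟨le_max_of_le_left (le_max_left _ _), le_max_of_le_left (le_max_of_le_right (le_max_left _ _)),
        le_max_of_le_left (le_max_of_le_right (le_max_right _ _)), le_max_right _ _⟩
    obtain ⟨h₁, h₂, h₃, h₄⟩ := key a b c
    obtain ⟨h₁', h₂', h₃', h₄'⟩ := key a' b' c'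
    have e : t * (a + a' + (b + b') + (c + c')) = t * (a + b + c) + t * (a' + b' + c') := by ring
    refine max_le (max_le ?_ (max_le ?_ ?_)) ?_ <;> linarith
  -- flattening from below
  · intro a b c
    exact le_max_left _ _
  -- `a + b + c` from above
  · intro a b c ha hb hc
    have e : t * (a + b + c) ≤ 1 * (a + b + c) := mul_le_mul_of_nonneg_right (by linarith) (by linarith)
    refine max_le (max_le ?_ (max_le ?_ ?_)) ?_ <;> linarith
  -- within `(t - 2/3)·(a+b+c)` of flattening
  · intro a b c ha hb hc
    have m₁ : a + b ≤ max (a + b) (max (b + c) (a + c)) := le_max_left _ _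
    have m₂ : b + c ≤ max (a + b) (max (b + c) (a + c)) := le_max_of_le_right (le_max_left _ _)
    have m₃ : a + c ≤ max (a + b) (max (b + c) (a + c)) := le_max_of_le_right (le_max_right _ _)
    have hnn : 0 ≤ (t - 2 / 3) * (a + b + c) := mul_nonneg (by linarith) (by linarith)
    refine max_le (by linarith) ?_
    nlinarith
  -- flat while `t (2 + p) ≤ 2`
  · intro p hp0 hp
    have hp1 : p < 1 := by nlinarith
    apply le_antisymm
    · refine max_le (max_le ?_ (max_le ?_ ?_)) ?_ <;> linarith
    · exact le_max_of_le_left (le_max_of_le_right (le_max_of_le_right (by norm_num)))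
  -- VXXZ 2024, Table 1 (dominated by the `t = 3/4` model)
  · intro κ b hmem
    obtain ⟨hκ, hrow⟩ := vxxz2024Table_rows _ hmem
    refine le_trans (max_le_max le_rfl ?_) hrow
    exact mul_le_mul_of_nonneg_right ht' (by linarith)
  -- ADVXXZ 2025, Table 1
  · intro κ b hmem
    obtain ⟨hκ, hrow⟩ := advxxz2025Table_rows _ hmem
    refine le_trans (max_le_max le_rfl ?_) hrow
    exact mul_le_mul_of_nonneg_right ht' (by linarith)
  -- the exchange defect at the cell with meet (1,1,1) is exactly `3t - 2`
  · have e₁ : max (max ((2 : ℝ) + 1) (max (1 + 1) (2 + 1))) (t * (2 + 1 + 1)) = 3 :=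
      le_antisymm (max_le (by norm_num) (by linarith)) (le_max_of_le_left (by norm_num))
    have e₂ : max (max ((1 : ℝ) + 2) (max (2 + 1) (1 + 1))) (t * (1 + 2 + 1)) = 3 :=
      le_antisymm (max_le (by norm_num) (by linarith)) (le_max_of_le_left (by norm_num))
    have e₃ : max (max ((2 : ℝ) + 2) (max (2 + 1) (2 + 1))) (t * (2 + 2 + 1)) = 4 :=
      le_antisymm (max_le (by norm_num) (by linarith)) (le_max_of_le_left (by norm_num))
    have e₄ : max (max ((1 : ℝ) + 1) (max (1 + 1) (1 + 1))) (t * (1 + 1 + 1)) = 3 * t :=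
      le_antisymm (max_le (by norm_num; linarith) (by linarith)) (le_max_of_le_right (by linarith))
    beta_reduce
    rw [e₁, e₂, e₃, e₄]
    ring

end Summit.MatrixMultiplication.MatrixMultiplication.Theorems.ShapeSubmodular
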